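import Summits.Parity.GeneralizedHardyLittlewood.Theorems.GreenTaoLevelTwoMNTwoPolarization
import Summits.Parity.GeneralizedHardyLittlewood.Theorems.GreenTaoLevelTwoMNTwoDepolarizeStep

/-!
# Route `GreenTaoLevelTwo`, crux `MNTwo` (stmt-Parity-21276), line `birth`, stub `stub_mnVertical`:
# Lemma 28 "major arcs have small second derivative, III" — clearing denominators (GT 2008b §11)

Block V5 / H5 of the `stub_mnVertical` census (B. Green, T. Tao, *Quadratic uniformity of the
Möbius function*, Ann. Inst. Fourier 58 (2008) = arXiv:math/0606087, §11, Lemma 28: from Lemma 27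
(`‖q_{h,h'}φ''(h,h')‖ ≲ ‖h‖_g‖h'‖_g` with `q_{h,h'} ≲ 1` DEPENDING on `h,h'`) to a SINGLE `q ≲ 1`:
"it is possible to “clear denominators” and make `q` independent of `h,h'`, by taking advantage of
a certain “finite dimensionality” of the Bohr set … by Lemma (major-2) we may find for each `j,j'`
a `q_{j,j'} ≲ 1` such that `‖q_{j,j'}φ''(v_j,v_{j'})‖ ≲ 1/(L_jL_{j'})`.  If we let `q` be the least
common multiple of all the `q_{j,j'}`, then we still have `q ≲ 1` … By bilinearity (bilinear) it
follows that `‖qφ''(h,h')‖ ≲ ‖h‖_P‖h'‖_P` for all `h,h' ∈ P`").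

This def-free file is the ALGEBRAIC HALF of Lemma 28, in the abstract gauge vocabulary of
`…MNTwoLocalQuadratic` / `…MNTwoPolarization` / `…MNTwoDepolarize`: given "generators"
`v₀,…,v_{d−1}` of small gauge and integer coordinates `h = Σ cⱼvⱼ`, `h' = Σ c'ⱼvⱼ` with
`Σ|cⱼ|ν(vⱼ)`, `Σ|c'ⱼ|ν(vⱼ)` small, the second derivative expands bilinearly, the `d²` denominators
of the pairs `(vⱼ,v_{j'})` are cleared by their product, and
`‖qφ''(h,h')‖ ≤ Q^{d²}K (Σ|cⱼ|ν(vⱼ))(Σ|c'ⱼ|ν(vⱼ))` with ONE `q ≤ Q^{d²}`.  The geometric half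
(reduced coordinates on the rotation Bohr set with `Σ|cⱼ|ν(vⱼ) ≲ ν(h)`, the paper's
`‖h‖_P ≲ ‖h‖_g`) is a separate file.

* `gauge_sum_le` — `ν(Σ cⱼvⱼ) ≤ Σ|cⱼ|ν(vⱼ)`;
* `second_deriv_sum_left`, `second_deriv_sum_sum` — (bilinear) for integer combinations;
* `norm_zsmul_second_deriv_le` — the resulting bound for a common denominator;
* `exists_common_denominator` — product of finitely many denominators `≤ Q`;
* `clear_denominators` — **Lemma 28, algebraic half**.

References: [GreenTao2008QuadraticMobius] arXiv:math/0606087 §11, Lemma 28.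
-/

noncomputable section

open Finset Real

namespace Summit.Parity.GeneralizedHardyLittlewood.GreenTaoLevelTwoMNTwoClearDenominators

open Summit.Parity.GeneralizedHardyLittlewood.GreenTaoLevelTwoMNTwoLocalQuadratic
  (second_deriv_add_left second_deriv_comm)
open Summit.Parity.GeneralizedHardyLittlewood.GreenTaoLevelTwoMNTwoPolarization
  (gauge_zsmul_le second_deriv_zsmul_left second_deriv_zero_left)
open Summit.Parity.GeneralizedHardyLittlewood.GreenTaoLevelTwoMNTwoDepolarizeStep
  (norm_natCast_zsmul_le)

section Algebra

variable {G : Type*} [AddCommGroup G]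

/-- Gauge of an integer combination: `ν(Σ_{j∈s} cⱼvⱼ) ≤ Σ_{j∈s} |cⱼ| ν(vⱼ)` (symmetric subadditive
gauge with `ν 0 = 0`). [folklore] -/
theorem gauge_sum_le (ν : ℤ → ℝ) (hν0 : ν 0 = 0) (hνneg : ∀ x, ν (-x) = ν x)
    (hνadd : ∀ x y, ν (x + y) ≤ ν x + ν y) {d : ℕ} (v c : Fin d → ℤ) (s : Finset (Fin d)) :
    ν (∑ j ∈ s, c j * v j) ≤ ∑ j ∈ s, |(c j : ℝ)| * ν (v j) := by
  classical
  induction s using Finset.induction_on with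
  | empty => simp [hν0]
  | insert a s ha ih =>
    rw [Finset.sum_insert ha, Finset.sum_insert ha]
    calc ν (c a * v a + ∑ j ∈ s, c j * v j) ≤ ν (c a * v a) + ν (∑ j ∈ s, c j * v j) := hνadd _ _
      _ ≤ |(c a : ℝ)| * ν (v a) + ∑ j ∈ s, |(c j : ℝ)| * ν (v j) :=
          add_le_add (gauge_zsmul_le ν hν0 hνneg hνadd (v a) (c a)) ih

/-- **(bilinear) for an integer combination in the first slot.**  If `Σ_{j∈s}|cⱼ|ν(vⱼ) < r`,
`ν(vⱼ) < r` for all `j`, `ν b < r` and `3r ≤ R`, then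
`φ''(Σ_{j∈s} cⱼvⱼ, b) = Σ_{j∈s} cⱼ • φ''(vⱼ, b)`.
[cite: GreenTao2008QuadraticMobius, §9 eq. (bilinear), §11 (proof of Lemma 28)] -/
theorem second_deriv_sum_left (ν : ℤ → ℝ) (hν0 : ν 0 = 0) (hνnn : ∀ x, 0 ≤ ν x)
    (hνneg : ∀ x, ν (-x) = ν x) (hνadd : ∀ x y, ν (x + y) ≤ ν x + ν y) (φ : ℤ → G) {n₀ : ℤ}
    {R : ℝ}
    (hφ : ∀ n a b c : ℤ, ν (n - n₀) < R → ν (n + a - n₀) < R → ν (n + b - n₀) < R →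
      ν (n + c - n₀) < R → ν (n + a + b - n₀) < R → ν (n + a + c - n₀) < R →
      ν (n + b + c - n₀) < R → ν (n + a + b + c - n₀) < R →
      φ (n + a + b + c) - φ (n + a + b) - φ (n + a + c) - φ (n + b + c)
        + φ (n + a) + φ (n + b) + φ (n + c) - φ n = 0)
    {d : ℕ} (v c : Fin d → ℤ) {b : ℤ} {r : ℝ} (hv : ∀ j, ν (v j) < r) (hb : ν b < r)
    (hR : 3 * r ≤ R) :
    ∀ s : Finset (Fin d), ∑ j ∈ s, |(c j : ℝ)| * ν (v j) < r →
      φ (n₀ + (∑ j ∈ s, c j * v j) + b) - φ (n₀ + ∑ j ∈ s, c j * v j) - φ (n₀ + b) + φ n₀ =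
        ∑ j ∈ s, c j • (φ (n₀ + v j + b) - φ (n₀ + v j) - φ (n₀ + b) + φ n₀) := by
  classical
  intro s
  induction s using Finset.induction_on with
  | empty =>
    intro _
    simp only [Finset.sum_empty, add_zero]
    abel
  | insert a s ha ih =>
    intro hs
    rw [Finset.sum_insert ha] at hs
    have hnn : ∀ j, 0 ≤ |(c j : ℝ)| * ν (v j) := fun j => mul_nonneg (abs_nonneg _) (hνnn _)
    have hsum_nn : 0 ≤ ∑ j ∈ s, |(c j : ℝ)| * ν (v j) := Finset.sum_nonneg fun j _ => hnn j
    have hca : |(c a : ℝ)| * ν (v a) < r := by linarith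
    have hs' : ∑ j ∈ s, |(c j : ℝ)| * ν (v j) < r := by linarith [hnn a]
    have hx : ν (c a * v a) < r := lt_of_le_of_lt (gauge_zsmul_le ν hν0 hνneg hνadd (v a) (c a)) hca
    have hy : ν (∑ j ∈ s, c j * v j) < r :=
      lt_of_le_of_lt (gauge_sum_le ν hν0 hνneg hνadd v c s) hs'
    rw [Finset.sum_insert ha, Finset.sum_insert ha,
      second_deriv_add_left ν hν0 hνnn hνadd φ hφ hx hy hb hR, ih hs',
      second_deriv_zsmul_left ν hν0 hνnn hνneg hνadd φ hφ (c a) hca (hv a) hb hR]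

/-- **(bilinear) in both slots.**  If `Σ|cⱼ|ν(vⱼ) < r`, `Σ|c'ⱼ|ν(vⱼ) < r`, `ν(vⱼ) < r`, `3r ≤ R`,
then `φ''(Σcⱼvⱼ, Σc'ⱼvⱼ) = Σ_j Σ_{j'} (cⱼc'_{j'}) • φ''(vⱼ, v_{j'})`.
[cite: GreenTao2008QuadraticMobius, §11 (proof of Lemma 28, "By bilinearity (bilinear)")] -/
theorem second_deriv_sum_sum (ν : ℤ → ℝ) (hν0 : ν 0 = 0) (hνnn : ∀ x, 0 ≤ ν x)
    (hνneg : ∀ x, ν (-x) = ν x) (hνadd : ∀ x y, ν (x + y) ≤ ν x + ν y) (φ : ℤ → G) {n₀ : ℤ}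
    {R : ℝ}
    (hφ : ∀ n a b c : ℤ, ν (n - n₀) < R → ν (n + a - n₀) < R → ν (n + b - n₀) < R →
      ν (n + c - n₀) < R → ν (n + a + b - n₀) < R → ν (n + a + c - n₀) < R →
      ν (n + b + c - n₀) < R → ν (n + a + b + c - n₀) < R →
      φ (n + a + b + c) - φ (n + a + b) - φ (n + a + c) - φ (n + b + c)
        + φ (n + a) + φ (n + b) + φ (n + c) - φ n = 0)
    {d : ℕ} (v c c' : Fin d → ℤ) {r : ℝ} (hv : ∀ j, ν (v j) < r)
    (hc : ∑ j, |(c j : ℝ)| * ν (v j) < r) (hc' : ∑ j, |(c' j : ℝ)| * ν (v j) < r)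
    (hR : 3 * r ≤ R) :
    φ (n₀ + (∑ j, c j * v j) + ∑ j, c' j * v j) - φ (n₀ + ∑ j, c j * v j) -
        φ (n₀ + ∑ j, c' j * v j) + φ n₀ =
      ∑ j, ∑ j', (c j * c' j') •
        (φ (n₀ + v j + v j') - φ (n₀ + v j) - φ (n₀ + v j') + φ n₀) := by
  classical
  have hb : ν (∑ j, c' j * v j) < r :=
    lt_of_le_of_lt (gauge_sum_le ν hν0 hνneg hνadd v c' Finset.univ) hc'
  rw [second_deriv_sum_left ν hν0 hνnn hνneg hνadd φ hφ v c hv hb hR Finset.univ hc]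
  refine Finset.sum_congr rfl fun j _ => ?_
  -- `φ''(vⱼ, Σ c'v) = φ''(Σ c'v, vⱼ) = Σ_{j'} c'_{j'} • φ''(v_{j'}, vⱼ)`
  rw [second_deriv_comm φ n₀ (v j) (∑ j', c' j' * v j'),
    second_deriv_sum_left ν hν0 hνnn hνneg hνadd φ hφ v c' hv (hv j) hR Finset.univ hc',
    Finset.smul_sum]
  refine Finset.sum_congr rfl fun j' _ => ?_
  rw [second_deriv_comm φ n₀ (v j') (v j), mul_zsmul]

end Algebra

section Norms

variable {G : Type*} [NormedAddCommGroup G]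

/-- **The bound for a common denominator.**  Under the hypotheses of `second_deriv_sum_sum`, if
`‖q•φ''(vⱼ,v_{j'})‖ ≤ K ν(vⱼ)ν(v_{j'})` for all `j, j'`, then
`‖q•φ''(Σcⱼvⱼ, Σc'ⱼvⱼ)‖ ≤ K (Σ|cⱼ|ν(vⱼ)) (Σ|c'ⱼ|ν(vⱼ))`.
[cite: GreenTao2008QuadraticMobius, §11 (proof of Lemma 28, eq. (star-eq))] -/
theorem norm_zsmul_second_deriv_le (ν : ℤ → ℝ) (hν0 : ν 0 = 0) (hνnn : ∀ x, 0 ≤ ν x)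
    (hνneg : ∀ x, ν (-x) = ν x) (hνadd : ∀ x y, ν (x + y) ≤ ν x + ν y) (φ : ℤ → G) {n₀ : ℤ}
    {R : ℝ}
    (hφ : ∀ n a b c : ℤ, ν (n - n₀) < R → ν (n + a - n₀) < R → ν (n + b - n₀) < R →
      ν (n + c - n₀) < R → ν (n + a + b - n₀) < R → ν (n + a + c - n₀) < R →
      ν (n + b + c - n₀) < R → ν (n + a + b + c - n₀) < R →
      φ (n + a + b + c) - φ (n + a + b) - φ (n + a + c) - φ (n + b + c)
        + φ (n + a) + φ (n + b) + φ (n + c) - φ n = 0)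
    {d : ℕ} (v c c' : Fin d → ℤ) {r : ℝ} (hv : ∀ j, ν (v j) < r)
    (hc : ∑ j, |(c j : ℝ)| * ν (v j) < r) (hc' : ∑ j, |(c' j : ℝ)| * ν (v j) < r)
    (hR : 3 * r ≤ R) (q : ℤ) {K : ℝ}
    (hpair : ∀ j j', ‖q • (φ (n₀ + v j + v j') - φ (n₀ + v j) - φ (n₀ + v j') + φ n₀)‖ ≤
      K * ν (v j) * ν (v j')) :
    ‖q • (φ (n₀ + (∑ j, c j * v j) + ∑ j, c' j * v j) - φ (n₀ + ∑ j, c j * v j) -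
        φ (n₀ + ∑ j, c' j * v j) + φ n₀)‖ ≤
      K * (∑ j, |(c j : ℝ)| * ν (v j)) * (∑ j, |(c' j : ℝ)| * ν (v j)) := by
  rw [second_deriv_sum_sum ν hν0 hνnn hνneg hνadd φ hφ v c c' hv hc hc' hR, Finset.smul_sum]
  refine (norm_sum_le _ _).trans ?_
  rw [mul_assoc, Finset.sum_mul_sum, Finset.mul_sum]
  refine Finset.sum_le_sum fun j _ => ?_
  rw [Finset.smul_sum]
  refine (norm_sum_le _ _).trans ?_
  rw [Finset.mul_sum]
  refine Finset.sum_le_sum fun j' _ => ?_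
  rw [smul_comm]
  calc ‖(c j * c' j') • q • (φ (n₀ + v j + v j') - φ (n₀ + v j) - φ (n₀ + v j') + φ n₀)‖
      ≤ ‖(c j * c' j' : ℤ)‖ *
          ‖q • (φ (n₀ + v j + v j') - φ (n₀ + v j) - φ (n₀ + v j') + φ n₀)‖ := norm_zsmul_le _ _
    _ ≤ (|(c j : ℝ)| * |(c' j' : ℝ)|) * (K * ν (v j) * ν (v j')) := by
        refine mul_le_mul ?_ (hpair j j') (norm_nonneg _) (by positivity)
        rw [Int.norm_eq_abs]; push_cast; rw [abs_mul]
    _ = K * (|(c j : ℝ)| * ν (v j) * (|(c' j' : ℝ)| * ν (v j'))) := by ring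

/-- **Clearing finitely many denominators.**  If each `xᵢ` (`i` in a finite index type) has a
denominator `1 ≤ qᵢ ≤ Q` with `‖qᵢ•xᵢ‖ ≤ εᵢ` (`Q ≥ 1`), then the product `q = ∏ qᵢ`
satisfies `1 ≤ q ≤ Q^{#ι}` and `‖q•xᵢ‖ ≤ Q^{#ι} εᵢ` for every `i`.
[cite: GreenTao2008QuadraticMobius, §11 (proof of Lemma 28, "let `q` be the least common multiple")] -/
theorem exists_common_denominator {ι : Type*} [Fintype ι] [DecidableEq ι] (x : ι → G) {Q : ℝ}
    (hQ : 1 ≤ Q) (ε : ι → ℝ)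
    (h : ∀ i, ∃ q : ℕ, 1 ≤ q ∧ (q : ℝ) ≤ Q ∧ ‖((q : ℤ)) • x i‖ ≤ ε i) :
    ∃ q : ℕ, 1 ≤ q ∧ (q : ℝ) ≤ Q ^ Fintype.card ι ∧
      ∀ i, ‖((q : ℤ)) • x i‖ ≤ Q ^ Fintype.card ι * ε i := by
  choose f hf using h
  refine ⟨∏ i, f i, ?_, ?_, ?_⟩
  · exact Nat.one_le_iff_ne_zero.2 (Finset.prod_ne_zero_iff.2 fun i _ => by have := (hf i).1; omega)
  · push_cast
    calc ∏ i, (f i : ℝ) ≤ ∏ _i : ι, Q :=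
          Finset.prod_le_prod (fun i _ => Nat.cast_nonneg _) fun i _ => (hf i).2.1
      _ = Q ^ Fintype.card ι := by rw [Finset.prod_const, Finset.card_univ]
  · intro i
    have hsplit : (∏ j, f j : ℕ) = (∏ j ∈ Finset.univ.erase i, f j) * f i :=
      (Finset.prod_erase_mul _ _ (Finset.mem_univ i)).symm
    rw [hsplit, Nat.cast_mul, mul_zsmul]
    refine (norm_natCast_zsmul_le _ _).trans ?_
    have hP : ((∏ j ∈ Finset.univ.erase i, f j : ℕ) : ℝ) ≤ Q ^ Fintype.card ι := by
      push_cast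
      calc ∏ j ∈ Finset.univ.erase i, (f j : ℝ) ≤ ∏ _j ∈ Finset.univ.erase i, Q :=
            Finset.prod_le_prod (fun j _ => Nat.cast_nonneg _) fun j _ => (hf j).2.1
        _ = Q ^ (Fintype.card ι - 1) := by
            rw [Finset.prod_const, Finset.card_erase_of_mem (Finset.mem_univ i), Finset.card_univ]
        _ ≤ Q ^ Fintype.card ι := pow_le_pow_right₀ hQ (Nat.sub_le _ _)
    exact mul_le_mul hP (hf i).2.2 (norm_nonneg _) (by positivity)

/-- **Lemma 28 (GT 2008b §11), algebraic half: one denominator for all of the Bohr set.**  Let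
`ν` be a symmetric subadditive gauge, `φ` locally quadratic on `B(n₀,R)` with values in a normed
group (`ℝ/ℤ`), `3ρ₂ ≤ R`, and suppose (Lemma 27) every pair `a, b` with `ν a, ν b < ρ₂` has some
`1 ≤ q ≤ Q` with `‖q•φ''(a,b)‖ ≤ K ν(a)ν(b)`.  Let `v₀,…,v_{d−1}` have `ν(vⱼ) < ρ₂`.  Then there is
ONE `1 ≤ q ≤ Q^{d²}` such that for all integer coordinates `c, c'` with `Σ|cⱼ|ν(vⱼ) < ρ₂`,
`Σ|c'ⱼ|ν(vⱼ) < ρ₂`: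
`‖q•φ''(Σcⱼvⱼ, Σc'ⱼvⱼ)‖ ≤ Q^{d²} K (Σ|cⱼ|ν(vⱼ)) (Σ|c'ⱼ|ν(vⱼ))`.
[cite: GreenTao2008QuadraticMobius, §11, Lemma 28] -/
theorem clear_denominators (ν : ℤ → ℝ) (hν0 : ν 0 = 0) (hνnn : ∀ x, 0 ≤ ν x)
    (hνneg : ∀ x, ν (-x) = ν x) (hνadd : ∀ x y, ν (x + y) ≤ ν x + ν y) (φ : ℤ → G) {n₀ : ℤ}
    {R : ℝ}
    (hφ : ∀ n a b c : ℤ, ν (n - n₀) < R → ν (n + a - n₀) < R → ν (n + b - n₀) < R →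
      ν (n + c - n₀) < R → ν (n + a + b - n₀) < R → ν (n + a + c - n₀) < R →
      ν (n + b + c - n₀) < R → ν (n + a + b + c - n₀) < R →
      φ (n + a + b + c) - φ (n + a + b) - φ (n + a + c) - φ (n + b + c)
        + φ (n + a) + φ (n + b) + φ (n + c) - φ n = 0)
    {ρ₂ Q K : ℝ} (hR : 3 * ρ₂ ≤ R) (hQ : 1 ≤ Q)
    (h27 : ∀ a b : ℤ, ν a < ρ₂ → ν b < ρ₂ → ∃ q : ℕ, 1 ≤ q ∧ (q : ℝ) ≤ Q ∧
      ‖((q : ℤ)) • (φ (n₀ + a + b) - φ (n₀ + a) - φ (n₀ + b) + φ n₀)‖ ≤ K * ν a * ν b)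
    {d : ℕ} (v : Fin d → ℤ) (hv : ∀ j, ν (v j) < ρ₂) :
    ∃ q : ℕ, 1 ≤ q ∧ (q : ℝ) ≤ Q ^ (d * d) ∧
      ∀ c c' : Fin d → ℤ, ∑ j, |(c j : ℝ)| * ν (v j) < ρ₂ → ∑ j, |(c' j : ℝ)| * ν (v j) < ρ₂ →
        ‖((q : ℤ)) • (φ (n₀ + (∑ j, c j * v j) + ∑ j, c' j * v j) - φ (n₀ + ∑ j, c j * v j) -
            φ (n₀ + ∑ j, c' j * v j) + φ n₀)‖ ≤
          Q ^ (d * d) * K * (∑ j, |(c j : ℝ)| * ν (v j)) * (∑ j, |(c' j : ℝ)| * ν (v j)) := by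
  classical
  -- the `d²` second derivatives of the generators and their denominators
  set x : Fin d × Fin d → G := fun p =>
    φ (n₀ + v p.1 + v p.2) - φ (n₀ + v p.1) - φ (n₀ + v p.2) + φ n₀ with hx
  set ε : Fin d × Fin d → ℝ := fun p => K * ν (v p.1) * ν (v p.2) with hε
  have hpair : ∀ p, ∃ q : ℕ, 1 ≤ q ∧ (q : ℝ) ≤ Q ∧ ‖((q : ℤ)) • x p‖ ≤ ε p := fun p =>
    h27 (v p.1) (v p.2) (hv p.1) (hv p.2)
  obtain ⟨q, hq1, hqQ, hqb⟩ := exists_common_denominator x hQ ε hpair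
  rw [Fintype.card_prod, Fintype.card_fin] at hqQ hqb
  refine ⟨q, hq1, hqQ, fun c c' hc hc' => ?_⟩
  have h := norm_zsmul_second_deriv_le ν hν0 hνnn hνneg hνadd φ hφ v c c' hv hc hc' hR (q : ℤ)
    (K := Q ^ (d * d) * K) (fun j j' => by
      have := hqb (j, j')
      simp only [hx, hε] at this
      calc _ ≤ Q ^ (d * d) * (K * ν (v j) * ν (v j')) := this
        _ = Q ^ (d * d) * K * ν (v j) * ν (v j') := by ring)
  exact h

end Norms

end Summit.Parity.GeneralizedHardyLittlewood.GreenTaoLevelTwoMNTwoClearDenominators
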